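import Summits.RiemannHypothesis.RiemannHypothesis.Theorems.SignConeSignConeOscillatoryExtremalNonnegMollify
import Mathlib.Analysis.Calculus.BumpFunction.Normed
import Mathlib.Analysis.Fourier.Convolution

/-!
# Line `dual_witness` of crux `SignConeOscillatory` (stmt-RiemannHypothesis-16302): X₂ ⇔ crux, II — the Friedrichs mollifier on
# a windowed finite-energy `L²` function

For `u ∈ L²`, `supp u ⊆ [-a, a]`, with finite archimedean energy `∫ |û(1/2+it)|² ρ(t) dt` (`ρ = Re ψ(1/4+it/2)`), the
mollifications `vₙ = u ⋆ Φₙ` by normalised smooth bumps `Φₙ` of radius `εₙ = a/(n+1)` are Weil tests with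
`tsupport vₙ ⊆ [-(a+εₙ), a+εₙ]`, `v̂ₙ = û · Φ̂ₙ` on the critical line with `|Φ̂ₙ| ≤ 1`, `|Φ̂ₙ(1/2+it) − 1| ≤ εₙ|t|`, hence
(Plancherel, dominated convergence) `∫|vₙ − u|² → 0` and `∫ |v̂ₙ|² ρ → ∫ |û|² ρ` (`exists_mollifier_seq`). [folklore]
-/

noncomputable section

-- `Summit.RiemannHypothesis.RiemannHypothesis.…` repeats a namespace component by design (D-0017 layout).
set_option linter.dupNamespace false

open scoped BigOperators ComplexConjugate Topology ENNReal
open MeasureTheory Set Filter Complex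

namespace Summit.RiemannHypothesis.RiemannHypothesis.Theorems.SignCone.DualWitness

open Literature.NumberTheory.LFunctions Literature.Analysis.SpecialFunctions

variable {a : ℝ} {u : ℝ → ℂ}

/-! ## One bump -/

section OneBump

variable {ε : ℝ}

/-- The complexified normalised bump of radius `ε` (inner radius `ε/2`). [folklore] -/
def bumpC (hε : 0 < ε) : ℝ → ℂ := fun x =>
  (((⟨ε / 2, ε, by positivity, by linarith⟩ : ContDiffBump (0 : ℝ)).normed volume x : ℝ) : ℂ)

/-- The bump is a Weil test. [folklore] -/
theorem isWeilTest_bumpC (hε : 0 < ε) : IsWeilTest (bumpC hε) :=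
  ⟨Complex.ofRealCLM.contDiff.comp (ContDiffBump.contDiff_normed _),
    (ContDiffBump.hasCompactSupport_normed _).comp_left (g := fun r : ℝ => (r : ℂ)) Complex.ofReal_zero⟩

/-- `supp Φ ⊆ ball 0 ε`. [folklore] -/
theorem support_bumpC_subset (hε : 0 < ε) : Function.support (bumpC hε) ⊆ Metric.ball (0 : ℝ) ε := by
  intro x hx
  have : ((⟨ε / 2, ε, by positivity, by linarith⟩ : ContDiffBump (0 : ℝ)).normed volume x) ≠ 0 := by
    simpa [bumpC] using hx
  have h := (ContDiffBump.support_normed_eq (⟨ε / 2, ε, by positivity, by linarith⟩ : ContDiffBump (0 : ℝ))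
    (μ := volume)) ▸ (Function.mem_support.mpr this)
  exact h

/-- `∫ Φ = 1` and `Φ ≥ 0`: `‖Φ̂(1/2+it)‖ ≤ 1`. [folklore] -/
theorem norm_weilMellin_bumpC_le (hε : 0 < ε) (t : ℝ) : ‖weilMellin (bumpC hε) (1 / 2 + t * I)‖ ≤ 1 := by
  set φ : ContDiffBump (0 : ℝ) := ⟨ε / 2, ε, by positivity, by linarith⟩ with hφ
  rw [add_comm, weilMellin_add_half]
  calc ‖∫ x : ℝ, bumpC hε x * cexp (t * I * x)‖ ≤ ∫ x : ℝ, ‖bumpC hε x * cexp (t * I * x)‖ :=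
        norm_integral_le_integral_norm _
    _ = ∫ x : ℝ, φ.normed volume x := by
        refine integral_congr_ae (Eventually.of_forall fun x => ?_)
        beta_reduce
        rw [norm_mul, show (t : ℂ) * I * x = ((t * x : ℝ) : ℂ) * I by push_cast; ring, Complex.norm_exp_ofReal_mul_I,
          mul_one, bumpC, Complex.norm_real, Real.norm_eq_abs, abs_of_nonneg (φ.nonneg_normed x)]
    _ = 1 := φ.integral_normed

/-- `‖Φ̂(1/2+it) − 1‖ ≤ ε |t|` (`|e^{itx} − 1| ≤ |t||x| ≤ |t| ε` on the support). [folklore] -/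
theorem norm_weilMellin_bumpC_sub_one_le (hε : 0 < ε) (t : ℝ) : ‖weilMellin (bumpC hε) (1 / 2 + t * I) - 1‖ ≤ ε * |t| := by
  set φ : ContDiffBump (0 : ℝ) := ⟨ε / 2, ε, by positivity, by linarith⟩ with hφ
  have hint1 : ∫ x : ℝ, bumpC hε x = 1 := by
    simp only [bumpC]; rw [integral_complex_ofReal, φ.integral_normed]; simp
  have hI : Integrable (fun x : ℝ => bumpC hε x * cexp (t * I * x)) := (isWeilTest_bumpC hε).integrable_mul (by fun_prop)
  have hI0 : Integrable (bumpC hε) := (isWeilTest_bumpC hε).1.continuous.integrable_of_hasCompactSupport (isWeilTest_bumpC hε).2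
  rw [add_comm, weilMellin_add_half, ← hint1, ← integral_sub hI hI0]
  calc ‖∫ x : ℝ, (bumpC hε x * cexp (t * I * x) - bumpC hε x)‖
      ≤ ∫ x : ℝ, ‖bumpC hε x * cexp (t * I * x) - bumpC hε x‖ := norm_integral_le_integral_norm _
    _ ≤ ∫ x : ℝ, φ.normed volume x * (ε * |t|) := by
        refine integral_mono_of_nonneg (Eventually.of_forall fun _ => norm_nonneg _)
          (((ContDiffBump.continuous_normed φ).mul continuous_const).integrable_of_hasCompactSupport
            (φ.hasCompactSupport_normed.mul_right)) (Eventually.of_forall fun x => ?_)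
        beta_reduce
        rw [← mul_sub_one, norm_mul, bumpC, Complex.norm_real, Real.norm_eq_abs, abs_of_nonneg (φ.nonneg_normed x)]
        by_cases hx : φ.normed volume x = 0
        · rw [hx]; simp
        · have hxε : |x| < ε := by
            have : x ∈ Metric.ball (0 : ℝ) ε := φ.support_normed_eq (μ := volume) ▸ Function.mem_support.mpr hx
            simpa using this
          refine mul_le_mul_of_nonneg_left ?_ (φ.nonneg_normed x)
          calc ‖cexp (t * I * x) - 1‖ = ‖cexp (I * ((t * x : ℝ) : ℂ)) - 1‖ := by congr 2; push_cast; ring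
            _ ≤ ‖(t * x : ℝ)‖ := Real.norm_exp_I_mul_ofReal_sub_one_le
            _ = |t| * |x| := by rw [Real.norm_eq_abs, abs_mul]
            _ ≤ ε * |t| := by nlinarith [abs_nonneg t, abs_nonneg x]
    _ = ε * |t| := by rw [integral_mul_const, φ.integral_normed, one_mul]

end OneBump

/-! ## Mollifying a windowed `L²` function -/

/-- Compact support from the window. [folklore] -/
theorem hasCompactSupport_of_support_subset (hsu : Function.support u ⊆ Icc (-a) a) : HasCompactSupport u :=
  HasCompactSupport.intro isCompact_Icc fun _ hx => Function.notMem_support.mp fun h => hx (hsu h)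

/-- The mollification `u ⋆ Φ` of a windowed `L²` function by a test `Φ` is a Weil test. [folklore] -/
theorem isWeilTest_conv_of_memLp (hu : MemLp u 2 volume) (hsu : Function.support u ⊆ Icc (-a) a) {Φ : ℝ → ℂ}
    (hΦ : IsWeilTest Φ) : IsWeilTest (weilConv u Φ) := by
  refine ⟨?_, ?_⟩
  · rw [weilConv_eq_convolution_real]
    exact hΦ.2.contDiff_convolution_right _ (integrable_of_memLp_two_of_support hu hsu).locallyIntegrable hΦ.1
  · exact (hasCompactSupport_of_support_subset hsu).convolution _ hΦ.2

/-- Its support: `tsupport (u ⋆ Φ_ε) ⊆ [-(a+ε), a+ε]`. [folklore] -/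
theorem tsupport_conv_bumpC_subset (hsu : Function.support u ⊆ Icc (-a) a) {ε : ℝ} (hε : 0 < ε) :
    tsupport (weilConv u (bumpC hε)) ⊆ Icc (-(a + ε)) (a + ε) := by
  refine closure_minimal ?_ isClosed_Icc
  intro x hx
  have h := support_convolution_subset (L := ContinuousLinearMap.mul ℂ ℂ) (μ := volume) (f := u) (g := bumpC hε) hx
  obtain ⟨y, hy, z, hz, rfl⟩ := Set.mem_add.mp h
  have hy' := hsu hy
  have hz' : |z| < ε := by simpa using support_bumpC_subset hε hz
  exact ⟨by linarith [hy'.1, (abs_lt.mp hz').1], by linarith [hy'.2, (abs_lt.mp hz').2]⟩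

/-- Its transform on the critical line: `(u ⋆ Φ)^(1/2+it) = û(1/2+it) Φ̂(1/2+it)` (Mathlib's convolution theorem). [folklore] -/
theorem weilMellin_conv_half (hui : Integrable u) {Φ : ℝ → ℂ} (hΦi : Integrable Φ) (t : ℝ) :
    weilMellin (weilConv u Φ) (1 / 2 + t * I) = weilMellin u (1 / 2 + t * I) * weilMellin Φ (1 / 2 + t * I) := by
  rw [weilMellin_half_eq_fourier, weilMellin_half_eq_fourier, weilMellin_half_eq_fourier, weilConv,
    Real.fourier_mul_convolution_eq hui hΦi]

/-- **The mollifier sequence.**  For a windowed `L²` function `u` of finite archimedean energy there are Weil tests `vₙ`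
with `tsupport vₙ ⊆ [-(a + a/(n+1)), a + a/(n+1)]`, `∫|vₙ − u|² → 0` and `∫ |v̂ₙ(1/2+it)|² ρ(t) dt → ∫ |û(1/2+it)|² ρ(t) dt`.
[folklore] -/
theorem exists_mollifier_seq : ∀ {a : ℝ} {u : ℝ → ℂ}, 0 < a → MemLp u 2 volume → Function.support u ⊆ Icc (-a) a → Integrable (fun t : ℝ => ‖weilMellin u (1 / 2 + t * I)‖ ^ 2 * reDigammaQuarter t) → ∃ v : ℕ → ℝ → ℂ, (∀ n, IsWeilTest (v n) ∧ tsupport (v n) ⊆ Icc (-(a + a / ((n : ℝ) + 1))) (a + a / ((n : ℝ) + 1))) ∧ Tendsto (fun n => ∫ x, ‖v n x - u x‖ ^ 2) atTop (𝓝 0) ∧ Tendsto (fun n => ∫ t : ℝ, ‖weilMellin (v n) (1 / 2 + t * I)‖ ^ 2 * reDigammaQuarter t) atTop (𝓝 (∫ t : ℝ, ‖weilMellin u (1 / 2 + t * I)‖ ^ 2 * reDigammaQuarter t)) := by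
  intro a u ha hu hsu hE
  have hεn : ∀ n : ℕ, 0 < a / ((n : ℝ) + 1) := fun n => by positivity
  set v : ℕ → ℝ → ℂ := fun n => weilConv u (bumpC (hεn n)) with hv
  have hui : Integrable u := integrable_of_memLp_two_of_support hu hsu
  have hvt : ∀ n, IsWeilTest (v n) := fun n => isWeilTest_conv_of_memLp hu hsu (isWeilTest_bumpC (hεn n))
  have hΦi : ∀ n, Integrable (bumpC (hεn n)) := fun n =>
    (isWeilTest_bumpC (hεn n)).1.continuous.integrable_of_hasCompactSupport (isWeilTest_bumpC (hεn n)).2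
  have hvhat : ∀ (n : ℕ) (t : ℝ), weilMellin (v n) (1 / 2 + t * I) = weilMellin u (1 / 2 + t * I) * weilMellin (bumpC (hεn n)) (1 / 2 + t * I) :=
    fun n t => weilMellin_conv_half hui (hΦi n) t
  set U : ℝ → ℝ := fun t => ‖weilMellin u (1 / 2 + t * I)‖ ^ 2 with hU
  have hUint : Integrable U := integrable_norm_sq_weilMellin_half hu hsu
  have hUcont : Continuous U := continuous_norm_sq_weilMellin_half_line' hu hsu
  have hmc : ∀ n, Continuous fun t : ℝ => weilMellin (bumpC (hεn n)) (1 / 2 + t * I) := fun n =>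
    (continuous_weilMellin (isWeilTest_bumpC (hεn n)).1.continuous (isWeilTest_bumpC (hεn n)).2).comp (by fun_prop)
  -- εₙ → 0
  have hε0 : Tendsto (fun n : ℕ => a / ((n : ℝ) + 1)) atTop (𝓝 0) := by
    have h := (tendsto_one_div_add_atTop_nhds_zero_nat).const_mul a
    rw [mul_zero] at h
    exact h.congr fun n => by ring
  -- pointwise convergence of the multipliers
  have hm1 : ∀ t : ℝ, Tendsto (fun n => weilMellin (bumpC (hεn n)) (1 / 2 + t * I)) atTop (𝓝 1) := by
    intro t
    rw [tendsto_iff_norm_sub_tendsto_zero]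
    refine squeeze_zero (fun n => norm_nonneg _) (fun n => norm_weilMellin_bumpC_sub_one_le (hεn n) t) ?_
    simpa using hε0.mul_const |t|
  refine ⟨v, fun n => ⟨hvt n, tsupport_conv_bumpC_subset hsu (hεn n)⟩, ?_, ?_⟩
  · -- `L²` convergence by Plancherel for the difference
    have hP : ∀ n, ∫ x, ‖v n x - u x‖ ^ 2 =
        (1 / (2 * Real.pi)) * ∫ t : ℝ, U t * ‖weilMellin (bumpC (hεn n)) (1 / 2 + t * I) - 1‖ ^ 2 := by
      intro n
      have h1 := two_pi_mul_integral_norm_sq_sub ((hvt n).1.continuous.integrable_of_hasCompactSupport (hvt n).2) hui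
        ((hvt n).1.continuous.memLp_of_hasCompactSupport (hvt n).2) hu
      have e : ∫ t : ℝ, ‖weilMellin (v n) (1 / 2 + t * I) - weilMellin u (1 / 2 + t * I)‖ ^ 2 =
          ∫ t : ℝ, U t * ‖weilMellin (bumpC (hεn n)) (1 / 2 + t * I) - 1‖ ^ 2 := by
        refine integral_congr_ae (Eventually.of_forall fun t => ?_)
        simp only [hU]
        rw [hvhat, ← mul_sub_one, norm_mul, mul_pow]
      rw [e] at h1
      have hpi : (2 * Real.pi : ℝ) ≠ 0 := by positivity
      rw [← h1]
      field_simp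
    simp_rw [hP]
    rw [show (0 : ℝ) = (1 / (2 * Real.pi)) * 0 by simp]
    refine Tendsto.const_mul _ ?_
    have hlim : Tendsto (fun n => ∫ t : ℝ, U t * ‖weilMellin (bumpC (hεn n)) (1 / 2 + t * I) - 1‖ ^ 2) atTop
        (𝓝 (∫ t : ℝ, U t * ‖(1 : ℂ) - 1‖ ^ 2)) := by
      refine tendsto_integral_of_dominated_convergence (fun t => 4 * U t) (fun n => ?_) (hUint.const_mul 4)
        (fun n => Eventually.of_forall fun t => ?_) (Eventually.of_forall fun t => ?_)
      · exact (hUcont.mul (((hmc n).sub continuous_const).norm.pow 2)).aestronglyMeasurable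
      · rw [Real.norm_eq_abs, abs_of_nonneg (by positivity)]
        have hb : ‖weilMellin (bumpC (hεn n)) (1 / 2 + t * I) - 1‖ ≤ 2 := by
          calc ‖weilMellin (bumpC (hεn n)) (1 / 2 + t * I) - 1‖
              ≤ ‖weilMellin (bumpC (hεn n)) (1 / 2 + t * I)‖ + ‖(1 : ℂ)‖ := norm_sub_le _ _
            _ ≤ 1 + 1 := add_le_add (norm_weilMellin_bumpC_le (hεn n) t) (by simp)
            _ = 2 := by norm_num
        have hU0 : 0 ≤ U t := by positivity
        have hsq : ‖weilMellin (bumpC (hεn n)) (1 / 2 + t * I) - 1‖ ^ 2 ≤ 4 := by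
          nlinarith [norm_nonneg (weilMellin (bumpC (hεn n)) (1 / 2 + t * I) - 1)]
        calc U t * ‖weilMellin (bumpC (hεn n)) (1 / 2 + t * I) - 1‖ ^ 2 ≤ U t * 4 := mul_le_mul_of_nonneg_left hsq hU0
          _ = 4 * U t := mul_comm _ _
      · exact ((hm1 t).sub_const 1).norm.pow 2 |>.const_mul (U t)
    simpa using hlim
  · -- energy convergence by dominated convergence
    have e : ∀ n, (∫ t : ℝ, ‖weilMellin (v n) (1 / 2 + t * I)‖ ^ 2 * reDigammaQuarter t) =
        ∫ t : ℝ, U t * reDigammaQuarter t * ‖weilMellin (bumpC (hεn n)) (1 / 2 + t * I)‖ ^ 2 := by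
      intro n
      refine integral_congr_ae (Eventually.of_forall fun t => ?_)
      simp only [hU]
      rw [hvhat, norm_mul, mul_pow]; ring
    simp_rw [e]
    have hlim : Tendsto (fun n => ∫ t : ℝ, U t * reDigammaQuarter t * ‖weilMellin (bumpC (hεn n)) (1 / 2 + t * I)‖ ^ 2) atTop
        (𝓝 (∫ t : ℝ, U t * reDigammaQuarter t * ‖(1 : ℂ)‖ ^ 2)) := by
      refine tendsto_integral_of_dominated_convergence (fun t => ‖U t * reDigammaQuarter t‖) (fun n => ?_) hE.norm
        (fun n => Eventually.of_forall fun t => ?_) (Eventually.of_forall fun t => ?_)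
      · exact ((hUcont.mul continuous_reDigammaQuarter).mul ((hmc n).norm.pow 2)).aestronglyMeasurable
      · simp only [norm_mul, Real.norm_eq_abs, abs_pow, abs_norm]
        exact mul_le_of_le_one_right (by positivity) (pow_le_one₀ (norm_nonneg _) (norm_weilMellin_bumpC_le (hεn n) t))
      · exact ((hm1 t).norm.pow 2).const_mul _
    have e2 : (∫ t : ℝ, ‖weilMellin u (1 / 2 + t * I)‖ ^ 2 * reDigammaQuarter t) =
        ∫ t : ℝ, U t * reDigammaQuarter t * ‖(1 : ℂ)‖ ^ 2 := by
      refine integral_congr_ae (Eventually.of_forall fun t => ?_); simp [hU]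
    rw [e2]; exact hlim

end Summit.RiemannHypothesis.RiemannHypothesis.Theorems.SignCone.DualWitness

end
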